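import Summits.QuantumFields.QCD.Theorems.PauliWegnerSeaChiralGluonicCompletionGlobalContinuum
import Summits.QuantumFields.QCD.Theorems.HeatSlicedQuarksRobustYangMillsHandoverTransferLevelOnePos
import Literature.MathematicalPhysics.QuantumFieldTheory.QCDTransferMatrix
import Literature.MathematicalPhysics.QuantumFieldTheory.QCDAsymptoticScalingCouplingDivergence

/-!
# Stub `stub_uniformNormGap` (V) of line `Sketch_ideator5_r2`, crux `ChiralGluonicCompletion` (stmt-QuantumFields-17498)
# — typing audit and the honest currency of V along `Hyp`-witnesses (worker W2, 2026-08-17)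

AUDIT NOTE (verdict `stub-blocked`; V itself is NOT proved here).
1. Typing.  `qcdTransferLevel`/`qcdTransferGap` are junk outside the guard `0 ≤ β ∧ ∀ f, −1 < m_f` (`sSup`/`sInf`
   conventions, `Real.log 0 = 0`).  Along every `Hyp`-witness and every positive tuple the guard holds EVENTUALLY in `k`
   and uniformly in the torus: `β_k → +∞` from `(reg.scheme 0 0 0).HasAsymptoticScaling` (`N_f ≤ 16`,
   `QCDRegularisation.tendsto_beta_atTop_of_hasAsymptoticScaling`) and `−1 < m_f(k)` from clause (i) of `PerMass`
   (`uniformNormGap_rangeGuard`).  Hence eventually, on EVERY torus `2S+1`, `0 < λ₁ ≤ λ₀`, the gap is the honest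
   `−log(λ₁/λ₀) ≥ 0` (landed `qcdTransferLevel_one_pos` of crux 8892,
   `Theorems/HeatSlicedQuarksRobustYangMillsHandoverTransferLevelOnePos.lean`) and V's inequality is literally the
   level-ratio bound `λ₁ ≤ e^{−a_kΔ} λ₀` that the assembly stub consumes as `‖R‖ ≤ e^{−a_kΔ}`
   (`uniformNormGap_currency`, `le_qcdTransferGap_iff_level_ratio`).  V is quantified `∀ᶠ k`, so the finitely many
   junk cutoffs are harmless; `NeZero (2S+1)` is a `Prop`, so the explicit instance `⟨Nat.succ_ne_zero _⟩` is
   definitionally the inferred one.  Verdict (a) MEANINGFUL: an honest witness satisfies V with any `Δ < M_π(m)`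
   (lightest state on the spatial torus `(2S+1)a_k ≥ (2L_k+1)a_k → ∞` is one pion at rest; torelons cost
   `σ(2S+1)a_k → ∞`; finite-size shifts are `o(1)`; the Aoki region `|m_q| ≲ a²Λ³` is left eventually at fixed `m > 0`).
   Not junk-provable (`0 ≤ gap` is all the tree gives; vacuum non-degeneracy is not a min–max fact) and not
   junk-refutable (a refutation needs a `Hyp`-witness).
2. Supplier search (Theses ×31, Theorems, Cruxes 8892/9737): NO decl gives a volume-uniform transfer gap for a GIVEN
   regularisation.  Every lattice-gap item at all `m > 0` is `∃ reg` (DiagonalSpine/GapBuysCauchyRate/CentreStabilisedCircle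
   `FullLatticeGap` 8928, GluonFreeDual `LatticeQCDGapAF`, MultibosonBridge `FullLatticeGapC`, WilsonMobilityGap
   `GluonicCompletion` 9152 ⇒ `QCDOf`); the `∀ reg` ones carry hypotheses `Hyp` lacks (CounterexampleMustBeHot
   `ColdInfraredGap`: cold certificate; GradientFlowSpecies `MassiveLatticeGap` 8922: existence-half data, threshold only;
   QuarkMassMonotone `LatticeGapMonotone` 8905: a gapped anchor; EulerDescent `RayDescent`: heavy gap).  Crux 8892
   `PinTheInfimum.stub_spectralDictionary` (open, XL) direction (⇒) turns `HasLatticeMassGap ε` at a tuple into V at rate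
   `ε/2` — so V FOLLOWS from the C1 node it is meant to feed (given X₀ data): V is C1 in transfer-matrix currency, in
   fact C1⁺ (it also excludes dark states), not a weakening.  Its open core is γ1, typed on the summit only at `N_f = 0`:
   `HeavyThresholdYMBridge.YMLatticeGapAlongAFSequences` (8796).
-/

noncomputable section

open MeasureTheory Filter Topology Matrix
open scoped Matrix.Norms.L2Operator ComplexOrder
open Literature.MathematicalPhysics.QuantumFieldTheory Literature.MathematicalPhysics.QuantumLattice
  Literature.Probability.LatticeModels
open Summit.QuantumFields.QCD.Theorems.StronglyChiralSubsequence
open Summit.QuantumFields.QCD.Cruxes.RobustYangMillsHandover.PinTheInfimum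
open Summit.QuantumFields.QCD.Cruxes.StableActionBridge.Sketch

namespace Summit.QuantumFields.QCD.Theorems.AnomalyBranch

variable {Nf : ℕ}

/-- **Lüscher's range guard along a `Hyp`-witness.**  For `N_f ∈ {2,3}`, every `Hyp`-witness `reg` and every positive
tuple `m`: eventually in `k` the inverse bare coupling is non-negative (`β_k → +∞` by asymptotic scaling) and all bare
masses `m_crit(k) + a_k m_f / Z_m(k)` lie in Lüscher's range `> −1` (clause (i) of the per-mass package) — the exact
guard inside which the tree's min–max levels `qcdTransferLevel` and the gap `qcdTransferGap` are not junk.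
[cite: Luscher1977, pp. 283–292] [cite: MontvayMunster1994, §3.3.3 (3.263)–(3.265) and §4.2.3 (4.111)] -/
theorem uniformNormGap_rangeGuard (hNf : Nf = 2 ∨ Nf = 3) (reg : QCDRegularisation Nf) (hH : Hyp Nf reg)
    (m : Fin Nf → ℝ) (hm : ∀ f, 0 < m f) :
    ∀ᶠ k in atTop, 0 ≤ reg.β k ∧ ∀ f, -1 < reg.mcrit k + reg.a k * m f / reg.Zm k := by
  have hNf16 : Nf ≤ 16 := by rcases hNf with rfl | rfl <;> norm_num
  have hβ : ∀ᶠ k in atTop, (0 : ℝ) ≤ reg.β k :=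
    (reg.tendsto_beta_atTop_of_hasAsymptoticScaling hNf16 0 0 0 hH.2.2.1).eventually_ge_atTop 0
  have hm1 : ∀ᶠ k in atTop, ∀ f, -1 < reg.mcrit k + reg.a k * m f / reg.Zm k :=
    eventually_all.2 (hH.2.2.2 m hm).1.1
  exact hβ.and hm1

/-- **Inside the guard, V's inequality is the level-ratio bound.**  For `N_f ≥ 1`, `β ≥ 0` and all `m_f > −1`, on any
spatial torus: `δ ≤ qcdTransferGap N_f β S m ↔ λ₁ ≤ e^{−δ} λ₀` (`0 < λ₁ ≤ λ₀`, `gap = log λ₀ − log λ₁`) — the form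
`‖R‖ = λ₁/λ₀ ≤ e^{−δ}` in which the twisted-trace clustering bound consumes a norm gap.
[cite: Luscher1977, pp. 283–292] [cite: ReedSimonIV1978, Thm XIII.1] -/
theorem le_qcdTransferGap_iff_level_ratio (Nf S : ℕ) [NeZero Nf] [NeZero S] (β : ℝ) (mq : Fin Nf → ℝ)
    (hβ : 0 ≤ β) (hm : ∀ f, -1 < mq f) (δ : ℝ) :
    δ ≤ qcdTransferGap Nf β S mq ↔
      qcdTransferLevel Nf S β mq 1 ≤ Real.exp (-δ) * qcdTransferLevel Nf S β mq 0 := by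
  have h1 : 0 < qcdTransferLevel Nf S β mq 1 := qcdTransferLevel_one_pos Nf S β mq hβ hm
  have h0 : 0 < qcdTransferLevel Nf S β mq 0 := TransferLevelBounds.qcdTransferLevel_zero_pos hβ hm
  rw [qcdTransferGap_eq]
  constructor
  · intro h
    -- `log λ₁ ≤ log λ₀ − δ = log (e^{−δ} λ₀)`
    have h' : Real.log (qcdTransferLevel Nf S β mq 1) ≤
        Real.log (Real.exp (-δ) * qcdTransferLevel Nf S β mq 0) := by
      rw [Real.log_mul (Real.exp_pos _).ne' h0.ne', Real.log_exp]
      linarith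
    exact (Real.log_le_log_iff h1 (mul_pos (Real.exp_pos _) h0)).1 h'
  · intro h
    have h' := Real.log_le_log h1 h
    rw [Real.log_mul (Real.exp_pos _).ne' h0.ne', Real.log_exp] at h'
    linarith

/-- **The currency of V is honest along every `Hyp`-witness** (registered sub-goal `uniformNormGap_currency` of
crux stmt-QuantumFields-17498, line `Sketch_ideator5_r2`; typing lemma for stub `stub_uniformNormGap`).  For
`N_f ∈ {2,3}`, every `Hyp`-witness `reg` and every positive tuple `m`: eventually in `k` the range guard holds
(`0 ≤ β_k`, all `m_f(k) > −1`) and, on EVERY spatial torus of side `2S+1` (in particular all `S ≥ L_k`), the two top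
min–max levels of Lüscher's transfer operator at `(β_k, m_f(k))` satisfy `0 < λ₁ ≤ λ₀`, the tree's gap is the honest
`−log(λ₁/λ₀) ≥ 0` (no `Real.log 0`, no `sSup` junk is consulted), and for every rate `δ` the norm-gap inequality
`δ ≤ qcdTransferGap` is equivalent to the level-ratio bound `λ₁ ≤ e^{−δ} λ₀`.  So stub V (`a_k Δ ≤ qcdTransferGap` on
all `S ≥ L_k`, eventually) is neither vacuous nor junk-valued along admissible witnesses: it fails exactly if
`λ₁/λ₀ > e^{−a_kΔ}` on some admissible torus frequently in `k`. [cite: Luscher1977, pp. 283–292] [cite: ReedSimonIV1978, Thm XIII.1] -/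
theorem uniformNormGap_currency : ∀ Nf : ℕ, Nf = 2 ∨ Nf = 3 → ∀ reg : QCDRegularisation Nf, Hyp Nf reg → ∀ m : Fin Nf → ℝ, (∀ f, 0 < m f) → ∀ᶠ k in atTop, (0 ≤ reg.β k ∧ ∀ f, -1 < reg.mcrit k + reg.a k * m f / reg.Zm k) ∧ ∀ S : ℕ, 0 < qcdTransferLevel Nf (2 * S + 1) (reg.β k) (fun f => reg.mcrit k + reg.a k * m f / reg.Zm k) 1 ∧ qcdTransferLevel Nf (2 * S + 1) (reg.β k) (fun f => reg.mcrit k + reg.a k * m f / reg.Zm k) 1 ≤ qcdTransferLevel Nf (2 * S + 1) (reg.β k) (fun f => reg.mcrit k + reg.a k * m f / reg.Zm k) 0 ∧ @qcdTransferGap Nf (reg.β k) (2 * S + 1) ⟨Nat.succ_ne_zero _⟩ (fun f => reg.mcrit k + reg.a k * m f / reg.Zm k) = -Real.log (qcdTransferLevel Nf (2 * S + 1) (reg.β k) (fun f => reg.mcrit k + reg.a k * m f / reg.Zm k) 1 / qcdTransferLevel Nf (2 * S + 1) (reg.β k) (fun f => reg.mcrit k + reg.a k * m f / reg.Zm k)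 0) ∧ 0 ≤ @qcdTransferGap Nf (reg.β k) (2 * S + 1) ⟨Nat.succ_ne_zero _⟩ (fun f => reg.mcrit k + reg.a k * m f / reg.Zm k) ∧ ∀ δ : ℝ, (δ ≤ @qcdTransferGap Nf (reg.β k) (2 * S + 1) ⟨Nat.succ_ne_zero _⟩ (fun f => reg.mcrit k + reg.a k * m f / reg.Zm k) ↔ qcdTransferLevel Nf (2 * S + 1) (reg.β k) (fun f => reg.mcrit k + reg.a k * m f / reg.Zm k) 1 ≤ Real.exp (-δ) * qcdTransferLevel Nf (2 * S + 1) (reg.β k) (fun f => reg.mcrit k + reg.a k * m f / reg.Zm k) 0) := by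
  intro Nf hNf reg hH m hm
  haveI : NeZero Nf := ⟨by rcases hNf with rfl | rfl <;> norm_num⟩
  filter_upwards [uniformNormGap_rangeGuard hNf reg hH m hm] with k hk
  obtain ⟨hβ, hm1⟩ := hk
  exact ⟨⟨hβ, hm1⟩, fun S => ⟨qcdTransferLevel_one_pos Nf (2 * S + 1) (reg.β k) _ hβ hm1,
    qcdTransferLevel_one_le_zero Nf (2 * S + 1) (reg.β k) _ hβ hm1,
    qcdTransferGap_eq_neg_log_div Nf (2 * S + 1) (reg.β k) _ hβ hm1,
    qcdTransferGap_nonneg Nf (2 * S + 1) (reg.β k) _ hβ hm1,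
    fun δ => le_qcdTransferGap_iff_level_ratio Nf (2 * S + 1) (reg.β k) _ hβ hm1 δ⟩⟩

/-- **V at rate `Δ` is the eventual level-ratio bound `λ₁ ≤ e^{−a_kΔ} λ₀` on all admissible tori** (the form consumed as
`‖R‖ ≤ e^{−a_kΔ}` by the twisted-trace clustering bound): along a `Hyp`-witness the two formulations of the uniform
norm gap are equivalent, rate by rate. [cite: Luscher1977, pp. 283–292] [cite: ReedSimonIV1978, Thm XIII.1] -/
theorem uniformNormGap_iff_level_ratio (hNf : Nf = 2 ∨ Nf = 3) (reg : QCDRegularisation Nf) (hH : Hyp Nf reg)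
    (m : Fin Nf → ℝ) (hm : ∀ f, 0 < m f) (Δ : ℝ) :
    (∀ᶠ k in atTop, ∀ S : ℕ, reg.L k ≤ S →
        reg.a k * Δ ≤ @qcdTransferGap Nf (reg.β k) (2 * S + 1) ⟨Nat.succ_ne_zero _⟩
          (fun f => reg.mcrit k + reg.a k * m f / reg.Zm k)) ↔
      ∀ᶠ k in atTop, ∀ S : ℕ, reg.L k ≤ S →
        qcdTransferLevel Nf (2 * S + 1) (reg.β k) (fun f => reg.mcrit k + reg.a k * m f / reg.Zm k) 1 ≤
          Real.exp (-(reg.a k * Δ)) *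
            qcdTransferLevel Nf (2 * S + 1) (reg.β k) (fun f => reg.mcrit k + reg.a k * m f / reg.Zm k) 0 := by
  have hc := uniformNormGap_currency Nf hNf reg hH m hm
  constructor
  · intro h
    filter_upwards [h, hc] with k hk hk' S hS
    exact ((hk'.2 S).2.2.2.2 (reg.a k * Δ)).1 (hk S hS)
  · intro h
    filter_upwards [h, hc] with k hk hk' S hS
    exact ((hk'.2 S).2.2.2.2 (reg.a k * Δ)).2 (hk S hS)

end Summit.QuantumFields.QCD.Theorems.AnomalyBranch

end
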